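import Mathlib
import HarnessLib
import Summits.ValiantsHypothesis.ValiantsHypothesis.Theorems.LacunarySymmetroidMatrixDescartesProductPlusOneRowTowerKPairLaw

/-!
# LINE (A) `product_plus_one` — the MASTER LAW «knee cluster below, poles anywhere ≥ p above it» (every support size, unswitched side)

Companion of ✓ `…RowTowerKPairLaw` (pair certificate `ψ₃ − p²ψ₁ − 6ψ₁² = ½ΣΣ w_l w_{l'} φ_p(λ_l − λ_{l'}) + A u Σ w_l φ_p(λ_l)`, `φ_p(g) = g²(p² − g²)`).
Here the negative-weight letters (poles) need NOT lie within `p` of each other: if the positive-weight letters (the bottom letter when `A > 0`, and the tail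
letters with `B_l < 0`) have rates in a window `[τ − p, τ]`, every tail letter with `B_l > 0` has rate `≥ τ + p`, and the row is UNSWITCHED
(`0 < A − Σ B_l x^{λ_l}`), then ★ `rowPsiK3_master_law`: `p²ψ₁ + 6ψ₁² ≤ ψ₃` — indeed `ψ₃ − p²ψ₁ − 6ψ₁² ≥ G := Σ_{B_l > 0} w_l φ_p(λ_l − τ) ≥ 0`
(`rowPsiK3_master_ge`), so the law is STRICT as soon as one pole letter has rate `> τ + p` (`rowPsiK3_gt_of_master_far`) or `ψ₁ ≠ 0`.
It contains the cloud law ✓ `rowPsiK3_gt_support` (`τ = 0`) and the unswitched half of the pair-gap law.  Tools: `phi_antitone` (`φ_p` decreases on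
`[p, ∞)`), `phi_sub_ge` (`a, b ≥ p ⇒ φ_p(a − b) ≥ φ_p(a) + φ_p(b)`), the pair bound `masterPair_ge`, the bottom bound `masterBottom_ge`.
Numerics first (`lab/mixed_law2.py`: 0 / 92 226 violations; the separation `τ + p` is sharp: 369 / 92 650 at `τ + p/2`).

Honest framing: calculus of rows (helpers); nothing closes a stub; `OneChangeFloorK3` / `WronskianBudgetK3` / 18050 / `MatrixDescartes` OPEN; `VP ≠ VNP` NOT proved.
No definitions, no named facts.
-/

set_option linter.dupNamespace false

namespace Summit.ValiantsHypothesis.ValiantsHypothesis.Theorems.LacunarySymmetroidMatrixDescartes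

namespace ProductPlusOne

open Finset
open scoped BigOperators

/-! ### §1 Two inequalities for `φ_p(g) = g²(p² − g²)` -/

/-- `φ_p` is non-increasing on `[p, ∞)`: `p ≤ g ≤ h ⇒ h²(p² − h²) ≤ g²(p² − g²)` (`p ≥ 0`). [this file's lemma] -/
theorem phi_antitone {p g h : ℝ} (hp : 0 ≤ p) (hg : p ≤ g) (hgh : g ≤ h) :
    h ^ 2 * (p ^ 2 - h ^ 2) ≤ g ^ 2 * (p ^ 2 - g ^ 2) := by
  have h1 : 0 ≤ h ^ 2 - g ^ 2 := by nlinarith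
  have h2 : 0 ≤ h ^ 2 + g ^ 2 - p ^ 2 := by nlinarith
  nlinarith [mul_nonneg h1 h2]

/-- For `a, b ≥ p ≥ 0`: `φ_p(a − b) ≥ φ_p(a) + φ_p(b)`. [this file's lemma] -/
theorem phi_sub_ge {p a b : ℝ} (hp : 0 ≤ p) (ha : p ≤ a) (hb : p ≤ b) :
    a ^ 2 * (p ^ 2 - a ^ 2) + b ^ 2 * (p ^ 2 - b ^ 2) ≤ (a - b) ^ 2 * (p ^ 2 - (a - b) ^ 2) := by
  have hφa : a ^ 2 * (p ^ 2 - a ^ 2) ≤ 0 := mul_nonpos_of_nonneg_of_nonpos (sq_nonneg _) (by nlinarith)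
  have hφb : b ^ 2 * (p ^ 2 - b ^ 2) ≤ 0 := mul_nonpos_of_nonneg_of_nonpos (sq_nonneg _) (by nlinarith)
  rcases le_or_gt ((a - b) ^ 2) (p ^ 2) with hin | hout
  · have : 0 ≤ (a - b) ^ 2 * (p ^ 2 - (a - b) ^ 2) := mul_nonneg (sq_nonneg _) (by linarith)
    linarith
  · -- `|a − b| > p`: compare with the larger of `a, b`
    rcases le_or_gt b a with hba | hab
    · -- `a − b ≥ p` (as `(a−b)² > p²` and `a − b ≥ 0`), and `a − b ≤ a`
      have hg : p ≤ a - b := by nlinarith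
      have := phi_antitone hp hg (by linarith : a - b ≤ a)
      linarith
    · have hg : p ≤ b - a := by nlinarith
      have := phi_antitone hp hg (by linarith : b - a ≤ b)
      have hev : (a - b) ^ 2 = (b - a) ^ 2 := by ring
      rw [hev]; linarith

variable {n : ℕ} (lam : Fin n → ℕ) (A : ℝ) (B : Fin n → ℝ)

/-! ### §2 The master law -/

/-- The pair bound: with `g_l = w_l φ_p(λ_l − τ)` on pole letters (`B_l > 0`) and `0` elsewhere, every term of the pair double sum is
`≥ w_l g_{l'} + g_l w_{l'}` (knees in `[τ − p, τ]`, poles `≥ τ + p`, `u > 0`). [this file's lemma] -/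
theorem masterPair_ge (p τ : ℕ) {x : ℝ} (hx : 0 < x) (hF : 0 < A - ∑ l, B l * x ^ (lam l))
    (hlow : ∀ l, B l < 0 → lam l ≤ τ ∧ τ ≤ lam l + p) (hhigh : ∀ l, 0 < B l → τ + p ≤ lam l) (l l' : Fin n) :
    (-(B l * x ^ (lam l))) * rowUK lam A B x * (if 0 < B l' then (-(B l' * x ^ (lam l'))) * rowUK lam A B x
          * ((((lam l' : ℕ) : ℝ) - τ) ^ 2 * ((p : ℝ) ^ 2 - (((lam l' : ℕ) : ℝ) - τ) ^ 2)) else 0)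
      + (if 0 < B l then (-(B l * x ^ (lam l))) * rowUK lam A B x
          * ((((lam l : ℕ) : ℝ) - τ) ^ 2 * ((p : ℝ) ^ 2 - (((lam l : ℕ) : ℝ) - τ) ^ 2)) else 0) * ((-(B l' * x ^ (lam l'))) * rowUK lam A B x)
    ≤ (-(B l * x ^ (lam l))) * rowUK lam A B x * ((-(B l' * x ^ (lam l'))) * rowUK lam A B x)
        * ((((lam l : ℕ) : ℝ) - ((lam l' : ℕ) : ℝ)) ^ 2 * ((p : ℝ) ^ 2 - (((lam l : ℕ) : ℝ) - ((lam l' : ℕ) : ℝ)) ^ 2)) := by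
  have hu := rowUK_pos lam A B hF
  have hp0 : (0 : ℝ) ≤ (p : ℝ) := Nat.cast_nonneg p
  -- signs of the weights
  have hwpos : ∀ i, B i < 0 → 0 ≤ (-(B i * x ^ (lam i))) * rowUK lam A B x := fun i hi => by
    have : 0 < -(B i * x ^ (lam i)) := by have := mul_neg_of_neg_of_pos hi (pow_pos hx (lam i)); linarith
    positivity
  have hwneg : ∀ i, 0 < B i → (-(B i * x ^ (lam i))) * rowUK lam A B x ≤ 0 := fun i hi => by
    have : -(B i * x ^ (lam i)) ≤ 0 := by have := mul_pos hi (pow_pos hx (lam i)); linarith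
    exact mul_nonpos_of_nonpos_of_nonneg this hu.le
  have hφneg : ∀ i, 0 < B i → (((lam i : ℕ) : ℝ) - τ) ^ 2 * ((p : ℝ) ^ 2 - (((lam i : ℕ) : ℝ) - τ) ^ 2) ≤ 0 := fun i hi => by
    have h := hhigh i hi
    have h' : (τ : ℝ) + p ≤ ((lam i : ℕ) : ℝ) := by exact_mod_cast h
    exact mul_nonpos_of_nonneg_of_nonpos (sq_nonneg _) (by nlinarith)
  set w : Fin n → ℝ := fun i => (-(B i * x ^ (lam i))) * rowUK lam A B x with hw
  set R : Fin n → ℝ := fun i => ((lam i : ℕ) : ℝ) with hR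
  show w l * (if 0 < B l' then w l' * ((R l' - τ) ^ 2 * ((p : ℝ) ^ 2 - (R l' - τ) ^ 2)) else 0)
      + (if 0 < B l then w l * ((R l - τ) ^ 2 * ((p : ℝ) ^ 2 - (R l - τ) ^ 2)) else 0) * w l'
    ≤ w l * w l' * ((R l - R l') ^ 2 * ((p : ℝ) ^ 2 - (R l - R l') ^ 2))
  rcases lt_trichotomy (B l) 0 with hl | hl | hl <;> rcases lt_trichotomy (B l') 0 with hl' | hl' | hl'
  · -- low, low: gap `≤ p`
    rw [if_neg (not_lt.2 hl.le), if_neg (not_lt.2 hl'.le), mul_zero, zero_mul, add_zero]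
    obtain ⟨h1, h2⟩ := hlow l hl
    obtain ⟨h1', h2'⟩ := hlow l' hl'
    have ha : R l ≤ (τ : ℝ) := by simp only [hR]; exact_mod_cast h1
    have hb : (τ : ℝ) ≤ R l + p := by simp only [hR]; exact_mod_cast h2
    have ha' : R l' ≤ (τ : ℝ) := by simp only [hR]; exact_mod_cast h1'
    have hb' : (τ : ℝ) ≤ R l' + p := by simp only [hR]; exact_mod_cast h2'
    have hgap : (R l - R l') ^ 2 ≤ (p : ℝ) ^ 2 := sq_le_sq' (by linarith) (by linarith)
    exact mul_nonneg (mul_nonneg (hwpos l hl) (hwpos l' hl')) (mul_nonneg (sq_nonneg _) (by linarith))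
  · have hw0 : w l' = 0 := by simp [hw, hl']
    simp [hw0, hl']
  · -- low `l`, high `l'`
    rw [if_pos hl', if_neg (not_lt.2 hl.le), zero_mul, add_zero]
    obtain ⟨h1, -⟩ := hlow l hl
    have hfar := hhigh l' hl'
    have ha : R l ≤ (τ : ℝ) := by simp only [hR]; exact_mod_cast h1
    have hb : (τ : ℝ) + p ≤ R l' := by simp only [hR]; exact_mod_cast hfar
    have hanti := phi_antitone hp0 (by linarith : (p : ℝ) ≤ R l' - τ) (by linarith : R l' - τ ≤ R l' - R l)
    have hev : (R l - R l') ^ 2 = (R l' - R l) ^ 2 := by ring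
    rw [hev]
    -- `w_l ≥ 0`, `w_{l'} ≤ 0`: multiply the antitone inequality by `w_l w_{l'} ≤ 0`
    have hww : w l * w l' ≤ 0 := mul_nonpos_of_nonneg_of_nonpos (hwpos l hl) (hwneg l' hl')
    have := mul_le_mul_of_nonpos_left hanti hww
    linarith
  · have hw0 : w l = 0 := by simp [hw, hl]
    simp [hw0, hl]
  · have hw0 : w l = 0 := by simp [hw, hl]
    simp [hw0, hl]
  · have hw0 : w l = 0 := by simp [hw, hl]
    simp [hw0, hl]
  · -- high `l`, low `l'`
    rw [if_neg (not_lt.2 hl'.le), if_pos hl, mul_zero, zero_add]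
    obtain ⟨h1, -⟩ := hlow l' hl'
    have hfar := hhigh l hl
    have ha : R l' ≤ (τ : ℝ) := by simp only [hR]; exact_mod_cast h1
    have hb : (τ : ℝ) + p ≤ R l := by simp only [hR]; exact_mod_cast hfar
    have hanti := phi_antitone hp0 (by linarith : (p : ℝ) ≤ R l - τ) (by linarith : R l - τ ≤ R l - R l')
    have hww : w l * w l' ≤ 0 := mul_nonpos_of_nonpos_of_nonneg (hwneg l hl) (hwpos l' hl')
    have := mul_le_mul_of_nonpos_left hanti hww
    linarith
  · have hw0 : w l' = 0 := by simp [hw, hl']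
    simp [hw0, hl']
  · -- high, high
    rw [if_pos hl, if_pos hl']
    have hb : (τ : ℝ) + p ≤ R l := by simp only [hR]; exact_mod_cast hhigh l hl
    have hb' : (τ : ℝ) + p ≤ R l' := by simp only [hR]; exact_mod_cast hhigh l' hl'
    have hsub := phi_sub_ge hp0 (by linarith : (p : ℝ) ≤ R l - τ) (by linarith : (p : ℝ) ≤ R l' - τ)
    have hev : (R l - τ - (R l' - τ)) = R l - R l' := by ring
    rw [hev] at hsub
    have hww : 0 ≤ w l * w l' := mul_nonneg_of_nonpos_of_nonpos (hwneg l hl) (hwneg l' hl')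
    have := mul_le_mul_of_nonneg_left hsub hww
    linarith

/-- The bottom bound: `A u · w_l φ_p(λ_l) ≥ A u · g_l` (`A ≥ 0`; rate `0` in the knee window when `A ≠ 0`, i.e. `τ ≤ p`). [this file's lemma] -/
theorem masterBottom_ge (p τ : ℕ) {x : ℝ} (hx : 0 < x) (hF : 0 < A - ∑ l, B l * x ^ (lam l)) (hA : 0 ≤ A) (h0 : A ≠ 0 → τ ≤ p)
    (hlow : ∀ l, B l < 0 → lam l ≤ τ ∧ τ ≤ lam l + p) (hhigh : ∀ l, 0 < B l → τ + p ≤ lam l) (l : Fin n) :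
    A * rowUK lam A B x * (if 0 < B l then (-(B l * x ^ (lam l))) * rowUK lam A B x
          * ((((lam l : ℕ) : ℝ) - τ) ^ 2 * ((p : ℝ) ^ 2 - (((lam l : ℕ) : ℝ) - τ) ^ 2)) else 0)
    ≤ A * rowUK lam A B x * ((-(B l * x ^ (lam l))) * rowUK lam A B x * (((lam l : ℕ) : ℝ) ^ 2 * ((p : ℝ) ^ 2 - ((lam l : ℕ) : ℝ) ^ 2))) := by
  have hu := rowUK_pos lam A B hF
  have hp0 : (0 : ℝ) ≤ (p : ℝ) := Nat.cast_nonneg p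
  have hτ0 : (0 : ℝ) ≤ (τ : ℝ) := Nat.cast_nonneg τ
  rcases eq_or_ne A 0 with hA0 | hA0
  · rw [hA0]; simp
  have hτp : (τ : ℝ) ≤ (p : ℝ) := by exact_mod_cast h0 hA0
  have hAu : 0 ≤ A * rowUK lam A B x := mul_nonneg hA hu.le
  refine mul_le_mul_of_nonneg_left ?_ hAu
  rcases lt_trichotomy (B l) 0 with hl | hl | hl
  · rw [if_neg (not_lt.2 hl.le)]
    obtain ⟨h1, -⟩ := hlow l hl
    have ha : ((lam l : ℕ) : ℝ) ≤ (τ : ℝ) := by exact_mod_cast h1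
    have hl0 : (0 : ℝ) ≤ ((lam l : ℕ) : ℝ) := Nat.cast_nonneg _
    have hw : 0 ≤ (-(B l * x ^ (lam l))) * rowUK lam A B x := by
      have : 0 < -(B l * x ^ (lam l)) := by have := mul_neg_of_neg_of_pos hl (pow_pos hx (lam l)); linarith
      positivity
    have hsq : ((lam l : ℕ) : ℝ) ^ 2 ≤ (p : ℝ) ^ 2 := by nlinarith
    exact mul_nonneg hw (mul_nonneg (sq_nonneg _) (by linarith))
  · rw [hl]; simp
  · rw [if_pos hl]
    have hb : (τ : ℝ) + p ≤ ((lam l : ℕ) : ℝ) := by exact_mod_cast hhigh l hl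
    have hanti := phi_antitone hp0 (by linarith : (p : ℝ) ≤ ((lam l : ℕ) : ℝ) - τ) (by linarith : ((lam l : ℕ) : ℝ) - τ ≤ ((lam l : ℕ) : ℝ))
    have hw : (-(B l * x ^ (lam l))) * rowUK lam A B x ≤ 0 := by
      have : -(B l * x ^ (lam l)) ≤ 0 := by have := mul_pos hl (pow_pos hx (lam l)); linarith
      exact mul_nonpos_of_nonpos_of_nonneg this hu.le
    exact mul_le_mul_of_nonpos_left hanti hw

/-- ★ **THE MASTER LAW, quantitative form**: `ψ₃ − p²ψ₁ − 6ψ₁² ≥ G = Σ_{B_l > 0} w_l φ_p(λ_l − τ)` (each term `≥ 0`). [this file's theorem] -/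
theorem rowPsiK3_master_ge (p τ : ℕ) {x : ℝ} (hx : 0 < x) (hF : 0 < A - ∑ l, B l * x ^ (lam l)) (hA : 0 ≤ A) (h0 : A ≠ 0 → τ ≤ p)
    (hlow : ∀ l, B l < 0 → lam l ≤ τ ∧ τ ≤ lam l + p) (hhigh : ∀ l, 0 < B l → τ + p ≤ lam l) :
    ∑ l, (if 0 < B l then (-(B l * x ^ (lam l))) * rowUK lam A B x
          * ((((lam l : ℕ) : ℝ) - τ) ^ 2 * ((p : ℝ) ^ 2 - (((lam l : ℕ) : ℝ) - τ) ^ 2)) else 0)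
      ≤ rowPsiK3 lam A B x - (p : ℝ) ^ 2 * rowPsiK1 lam A B x - 6 * rowPsiK1 lam A B x ^ 2 := by
  rw [rowPsiK3_pair_certificate lam A B (p : ℝ) hF.ne']
  have h1 : A * rowUK lam A B x + ∑ l, (-(B l * x ^ (lam l))) * rowUK lam A B x = 1 := rateWeights_sum_eq_one lam A B hF.ne'
  -- the double sum is `≥ 2 (Σ w)(Σ g)`
  have hpair : ∑ l, ∑ l', ((-(B l * x ^ (lam l))) * rowUK lam A B x * (if 0 < B l' then (-(B l' * x ^ (lam l'))) * rowUK lam A B x * ((((lam l' : ℕ) : ℝ) - τ) ^ 2 * ((p : ℝ) ^ 2 - (((lam l' : ℕ) : ℝ) - τ) ^ 2)) else 0) + (if 0 < B l then (-(B l * x ^ (lam l))) * rowUK lam A B x * ((((lam l : ℕ) : ℝ) - τ) ^ 2 * ((p : ℝ) ^ 2 - (((lam l : ℕ) : ℝ) - τ) ^ 2)) else 0) * ((-(B l' * x ^ (lam l'))) * rowUK lam A B x))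
      ≤ ∑ l, ∑ l', (-(B l * x ^ (lam l))) * rowUK lam A B x * ((-(B l' * x ^ (lam l'))) * rowUK lam A B x) * ((((lam l : ℕ) : ℝ) - ((lam l' : ℕ) : ℝ)) ^ 2 * ((p : ℝ) ^ 2 - (((lam l : ℕ) : ℝ) - ((lam l' : ℕ) : ℝ)) ^ 2)) :=
    Finset.sum_le_sum fun l _ => Finset.sum_le_sum fun l' _ => masterPair_ge lam A B p τ hx hF hlow hhigh l l'
  have hdouble : ∑ l, ∑ l', ((-(B l * x ^ (lam l))) * rowUK lam A B x * (if 0 < B l' then (-(B l' * x ^ (lam l'))) * rowUK lam A B x * ((((lam l' : ℕ) : ℝ) - τ) ^ 2 * ((p : ℝ) ^ 2 - (((lam l' : ℕ) : ℝ) - τ) ^ 2)) else 0) + (if 0 < B l then (-(B l * x ^ (lam l))) * rowUK lam A B x * ((((lam l : ℕ) : ℝ) - τ) ^ 2 * ((p : ℝ) ^ 2 - (((lam l : ℕ) : ℝ) - τ) ^ 2)) else 0) * ((-(B l' * x ^ (lam l'))) * rowUK lam A B x))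
      = 2 * ((∑ l, (-(B l * x ^ (lam l))) * rowUK lam A B x) * ∑ l, (if 0 < B l then (-(B l * x ^ (lam l))) * rowUK lam A B x * ((((lam l : ℕ) : ℝ) - τ) ^ 2 * ((p : ℝ) ^ 2 - (((lam l : ℕ) : ℝ) - τ) ^ 2)) else 0)) := by
    simp only [Finset.sum_add_distrib, ← Finset.mul_sum, ← Finset.sum_mul]
    ring
  -- the bottom sum is `≥ A u · Σ g`
  have hbottom : ∑ l, A * rowUK lam A B x * (if 0 < B l then (-(B l * x ^ (lam l))) * rowUK lam A B x * ((((lam l : ℕ) : ℝ) - τ) ^ 2 * ((p : ℝ) ^ 2 - (((lam l : ℕ) : ℝ) - τ) ^ 2)) else 0)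
      ≤ ∑ l, A * rowUK lam A B x * ((-(B l * x ^ (lam l))) * rowUK lam A B x * (((lam l : ℕ) : ℝ) ^ 2 * ((p : ℝ) ^ 2 - ((lam l : ℕ) : ℝ) ^ 2))) :=
    Finset.sum_le_sum fun l _ => masterBottom_ge lam A B p τ hx hF hA h0 hlow hhigh l
  rw [← Finset.mul_sum, ← Finset.mul_sum] at hbottom
  have hG : ∑ l, (if 0 < B l then (-(B l * x ^ (lam l))) * rowUK lam A B x * ((((lam l : ℕ) : ℝ) - τ) ^ 2 * ((p : ℝ) ^ 2 - (((lam l : ℕ) : ℝ) - τ) ^ 2)) else 0)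
      = A * rowUK lam A B x * ∑ l, (if 0 < B l then (-(B l * x ^ (lam l))) * rowUK lam A B x * ((((lam l : ℕ) : ℝ) - τ) ^ 2 * ((p : ℝ) ^ 2 - (((lam l : ℕ) : ℝ) - τ) ^ 2)) else 0) + (∑ l, (-(B l * x ^ (lam l))) * rowUK lam A B x) * ∑ l, (if 0 < B l then (-(B l * x ^ (lam l))) * rowUK lam A B x * ((((lam l : ℕ) : ℝ) - τ) ^ 2 * ((p : ℝ) ^ 2 - (((lam l : ℕ) : ℝ) - τ) ^ 2)) else 0) := by
    rw [← add_mul, h1, one_mul]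
  linarith

/-- ★ **THE MASTER LAW for every K** (unswitched row; knees — the bottom letter if `A ≠ 0` and the tail letters with `B_l < 0` — with rates in `[τ − p, τ]`;
poles — tail letters with `B_l > 0` — with rates `≥ τ + p`, otherwise ANYWHERE): `p²ψ₁ + 6ψ₁² ≤ ψ₃`. [this file's theorem] -/
theorem rowPsiK3_master_law (p τ : ℕ) {x : ℝ} (hx : 0 < x) (hF : 0 < A - ∑ l, B l * x ^ (lam l)) (hA : 0 ≤ A) (h0 : A ≠ 0 → τ ≤ p)
    (hlow : ∀ l, B l < 0 → lam l ≤ τ ∧ τ ≤ lam l + p) (hhigh : ∀ l, 0 < B l → τ + p ≤ lam l) :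
    (p : ℝ) ^ 2 * rowPsiK1 lam A B x + 6 * rowPsiK1 lam A B x ^ 2 ≤ rowPsiK3 lam A B x := by
  have h := rowPsiK3_master_ge lam A B p τ hx hF hA h0 hlow hhigh
  have hG : 0 ≤ ∑ l, (if 0 < B l then (-(B l * x ^ (lam l))) * rowUK lam A B x * ((((lam l : ℕ) : ℝ) - τ) ^ 2 * ((p : ℝ) ^ 2 - (((lam l : ℕ) : ℝ) - τ) ^ 2)) else 0) := by
    refine Finset.sum_nonneg fun l _ => ?_
    split_ifs with hl
    · have hb : (τ : ℝ) + p ≤ ((lam l : ℕ) : ℝ) := by exact_mod_cast hhigh l hl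
      have hp0 : (0 : ℝ) ≤ (p : ℝ) := Nat.cast_nonneg p
      have hw : (-(B l * x ^ (lam l))) * rowUK lam A B x ≤ 0 := by
        have : -(B l * x ^ (lam l)) ≤ 0 := by have := mul_pos hl (pow_pos hx (lam l)); linarith
        exact mul_nonpos_of_nonpos_of_nonneg this (rowUK_pos lam A B hF).le
      exact mul_nonneg_of_nonpos_of_nonpos hw (mul_nonpos_of_nonneg_of_nonpos (sq_nonneg _) (by nlinarith))
    · exact le_rfl
  linarith

/-- ★ (master law, strict from `ψ₁ ≠ 0`). [this file's theorem] -/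
theorem rowPsiK3_gt_of_master (p τ : ℕ) {x : ℝ} (hx : 0 < x) (hF : 0 < A - ∑ l, B l * x ^ (lam l)) (hA : 0 ≤ A) (h0 : A ≠ 0 → τ ≤ p)
    (hlow : ∀ l, B l < 0 → lam l ≤ τ ∧ τ ≤ lam l + p) (hhigh : ∀ l, 0 < B l → τ + p ≤ lam l) (hψ : rowPsiK1 lam A B x ≠ 0) :
    (p : ℝ) ^ 2 * rowPsiK1 lam A B x < rowPsiK3 lam A B x := by
  have h := rowPsiK3_master_law lam A B p τ hx hF hA h0 hlow hhigh
  have : 0 < rowPsiK1 lam A B x ^ 2 := by positivity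
  linarith

/-- ★ (master law, strict from a FAR pole) if some pole letter has rate `> τ + p`, then `p²ψ₁ < ψ₃`. [this file's theorem] -/
theorem rowPsiK3_gt_of_master_far (p τ : ℕ) {x : ℝ} (hx : 0 < x) (hF : 0 < A - ∑ l, B l * x ^ (lam l)) (hA : 0 ≤ A) (h0 : A ≠ 0 → τ ≤ p)
    (hlow : ∀ l, B l < 0 → lam l ≤ τ ∧ τ ≤ lam l + p) (hhigh : ∀ l, 0 < B l → τ + p ≤ lam l)
    (hfar : ∃ l, 0 < B l ∧ τ + p < lam l) :
    (p : ℝ) ^ 2 * rowPsiK1 lam A B x < rowPsiK3 lam A B x := by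
  have h := rowPsiK3_master_ge lam A B p τ hx hF hA h0 hlow hhigh
  have hu := rowUK_pos lam A B hF
  have hp0 : (0 : ℝ) ≤ (p : ℝ) := Nat.cast_nonneg p
  have hterm : ∀ l, 0 ≤ (if 0 < B l then (-(B l * x ^ (lam l))) * rowUK lam A B x * ((((lam l : ℕ) : ℝ) - τ) ^ 2 * ((p : ℝ) ^ 2 - (((lam l : ℕ) : ℝ) - τ) ^ 2)) else 0) := by
    intro l
    split_ifs with hl
    · have hb : (τ : ℝ) + p ≤ ((lam l : ℕ) : ℝ) := by exact_mod_cast hhigh l hl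
      have hw : (-(B l * x ^ (lam l))) * rowUK lam A B x ≤ 0 := by
        have : -(B l * x ^ (lam l)) ≤ 0 := by have := mul_pos hl (pow_pos hx (lam l)); linarith
        exact mul_nonpos_of_nonpos_of_nonneg this hu.le
      exact mul_nonneg_of_nonpos_of_nonpos hw (mul_nonpos_of_nonneg_of_nonpos (sq_nonneg _) (by nlinarith))
    · exact le_rfl
  obtain ⟨l₀, hl₀, hfar₀⟩ := hfar
  have hpos : 0 < (if 0 < B l₀ then (-(B l₀ * x ^ (lam l₀))) * rowUK lam A B x * ((((lam l₀ : ℕ) : ℝ) - τ) ^ 2 * ((p : ℝ) ^ 2 - (((lam l₀ : ℕ) : ℝ) - τ) ^ 2)) else 0) := by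
    rw [if_pos hl₀]
    have hb : (τ : ℝ) + p < ((lam l₀ : ℕ) : ℝ) := by exact_mod_cast hfar₀
    have hw : (-(B l₀ * x ^ (lam l₀))) * rowUK lam A B x < 0 := by
      have : -(B l₀ * x ^ (lam l₀)) < 0 := by have := mul_pos hl₀ (pow_pos hx (lam l₀)); linarith
      exact mul_neg_of_neg_of_pos this hu
    have hsq : 0 < (((lam l₀ : ℕ) : ℝ) - τ) ^ 2 := by
      have : ((lam l₀ : ℕ) : ℝ) - τ ≠ 0 := by linarith
      positivity
    exact mul_pos_of_neg_of_neg hw (mul_neg_of_pos_of_neg hsq (by nlinarith))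
  have hge : (if 0 < B l₀ then (-(B l₀ * x ^ (lam l₀))) * rowUK lam A B x * ((((lam l₀ : ℕ) : ℝ) - τ) ^ 2 * ((p : ℝ) ^ 2 - (((lam l₀ : ℕ) : ℝ) - τ) ^ 2)) else 0) ≤ ∑ l, (if 0 < B l then (-(B l * x ^ (lam l))) * rowUK lam A B x * ((((lam l : ℕ) : ℝ) - τ) ^ 2 * ((p : ℝ) ^ 2 - (((lam l : ℕ) : ℝ) - τ) ^ 2)) else 0) := Finset.single_le_sum (fun l _ => hterm l) (Finset.mem_univ l₀)
  have hsq : 0 ≤ rowPsiK1 lam A B x ^ 2 := sq_nonneg _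
  linarith

end ProductPlusOne

end Summit.ValiantsHypothesis.ValiantsHypothesis.Theorems.LacunarySymmetroidMatrixDescartes
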